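import Summits.Ventures.Crystal3D.Theorems.StickyWulffConstantPolycrystalWulffBoundArrangementRefinement
import Summits.Ventures.Crystal3D.Theorems.StickyWulffConstantPolycrystalWulffBoundConvexBounded

/-!
# `PolycrystalWulffBound`: from a `Poly` grain to `PolytopeCalculus`-ready disjoint polytopes (turnkey)

Route `StickyWulffConstant` of the venture `Summits/Ventures/Crystal3D`, crux `PolycrystalWulffBound`
(item `stmt-Ventures-19482`), second prover lane; companion of `…ArrangementCells`,
`…ArrangementRefinement` (cells of the hyperplane arrangement, repackaged in clause (B)'s format) and
`…ConvexBounded` (finite volume ⇒ bounded pieces).  This file removes the last two bookkeeping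
hypotheses — UNIT normals and BOUNDED pieces — so that the P stub's hypothesis
`Poly S : S = ⋃ i, ⋂ p ∈ H i, {⟪p.1, x⟫ < p.2}` together with `volume S < ⊤` (from `Tex`) can be fed
DIRECTLY to the facet calculus:

* `halfSpace_eq_of_fst_ne_zero` — `{⟪a, x⟫ < b} = {⟪‖a‖⁻¹a, x⟫ < ‖a‖⁻¹ b}` for `a ≠ 0`;
* `polytope_eq_empty_of_degenerate`, `polytope_eq_polytope_normalize` — a constraint `(0, b)` with
  `b ≤ 0` empties the polytope; otherwise the polytope equals that of the normalised constraints
  `(H.filter (·.1 ≠ 0)).image (fun p => (‖p.1‖⁻¹ • p.1, ‖p.1‖⁻¹ * p.2))` (unit normals);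
* `exists_disjoint_polytope_refinement_of_volume_lt_top` — for EVERY `H : Fin k → Finset (E × ℝ)`
  whose polyhedral set `⋃ i, polytope (H i)` has finite volume: finitely many bounded open
  H-polytopes with unit normals and pairwise distinct facet planes, pairwise disjoint, closures meeting
  inside planes `{⟪ν j j', x⟫ = b}` (`‖ν j j'‖ = 1`), contained in the polyhedral set and exhausting
  it a.e. — exactly the data of `PolytopeCalculus` (A)+(B).
WHAT THIS IS NOT: the facet calculus; nothing on the crux beyond bookkeeping.
-/

noncomputable section

namespace Summit.Ventures.Crystal3D.Theorems

open MeasureTheory Set Metric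
open scoped RealInnerProductSpace Classical ENNReal

variable {E : Type*} [NormedAddCommGroup E] [InnerProductSpace ℝ E] [FiniteDimensional ℝ E]
  [MeasurableSpace E] [BorelSpace E]

/-! ### Normalising the constraints -/

omit [FiniteDimensional ℝ E] [MeasurableSpace E] [BorelSpace E] in
/-- Rescaling a constraint with nonzero normal to a unit normal does not change the half-space. -/
theorem halfSpace_eq_of_fst_ne_zero {a : E} (ha : a ≠ 0) (b : ℝ) :
    {x : E | ⟪a, x⟫ < b} = {x : E | ⟪‖a‖⁻¹ • a, x⟫ < ‖a‖⁻¹ * b} := by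
  have hn : 0 < ‖a‖⁻¹ := inv_pos.2 (norm_pos_iff.2 ha)
  ext x
  simp only [mem_setOf_eq, real_inner_smul_left]
  exact ⟨fun h => mul_lt_mul_of_pos_left h hn, fun h => lt_of_mul_lt_mul_left h hn.le⟩

omit [FiniteDimensional ℝ E] [MeasurableSpace E] [BorelSpace E] in
/-- A degenerate constraint `(0, b)` with `b ≤ 0` empties the open polytope. -/
theorem polytope_eq_empty_of_degenerate (H : Finset (E × ℝ)) {p : E × ℝ} (hp : p ∈ H)
    (hp1 : p.1 = 0) (hp2 : p.2 ≤ 0) : (⋂ q ∈ H, {x : E | ⟪q.1, x⟫ < q.2}) = ∅ := by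
  ext x
  simp only [mem_iInter, mem_setOf_eq, mem_empty_iff_false, iff_false, not_forall, not_lt]
  exact ⟨p, hp, by rw [hp1, inner_zero_left]; exact hp2⟩

omit [FiniteDimensional ℝ E] [MeasurableSpace E] [BorelSpace E] in
/-- If no constraint is degenerate-empty, the open polytope equals the polytope of the NORMALISED
constraints (drop the trivially-true constraints `(0, b)`, `b > 0`; rescale the others to unit
normals). -/
theorem polytope_eq_polytope_normalize (H : Finset (E × ℝ)) (hH : ∀ p ∈ H, p.1 = 0 → 0 < p.2) :
    (⋂ q ∈ H, {x : E | ⟪q.1, x⟫ < q.2}) =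
      ⋂ q ∈ (H.filter (fun p => p.1 ≠ 0)).image (fun p : E × ℝ => (‖p.1‖⁻¹ • p.1, ‖p.1‖⁻¹ * p.2)),
        {x : E | ⟪q.1, x⟫ < q.2} := by
  rw [Finset.set_biInter_finset_image]
  ext x
  simp only [mem_iInter, mem_setOf_eq, Finset.mem_filter]
  constructor
  · intro h p hp
    exact (Set.ext_iff.1 (halfSpace_eq_of_fst_ne_zero hp.2 p.2) x).1 (h p hp.1)
  · intro h p hp
    by_cases hp1 : p.1 = 0
    · rw [hp1, inner_zero_left]; exact hH p hp hp1
    · exact (Set.ext_iff.1 (halfSpace_eq_of_fst_ne_zero hp1 p.2) x).2 (h p ⟨hp, hp1⟩)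

omit [InnerProductSpace ℝ E] [FiniteDimensional ℝ E] [MeasurableSpace E] [BorelSpace E] in
/-- Normalised constraints have unit normals. -/
theorem norm_fst_eq_one_of_mem_normalize [NormedSpace ℝ E] (H : Finset (E × ℝ)) {q : E × ℝ}
    (hq : q ∈ (H.filter (fun p => p.1 ≠ 0)).image
      (fun p : E × ℝ => (‖p.1‖⁻¹ • p.1, ‖p.1‖⁻¹ * p.2))) : ‖q.1‖ = 1 := by
  obtain ⟨p, hp, rfl⟩ := Finset.mem_image.1 hq
  have hp1 : p.1 ≠ 0 := (Finset.mem_filter.1 hp).2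
  simp only [norm_smul, norm_inv, norm_norm]
  exact inv_mul_cancel₀ (norm_ne_zero_iff.2 hp1)

/-! ### The turnkey refinement -/

/-- **From a `Poly` set of finite volume to `PolytopeCalculus`-ready data.** For every finite family
`H : Fin k → Finset (E × ℝ)` of constraint sets whose polyhedral set `S = ⋃ i, ⋂_{p ∈ H i} {⟪p.1,x⟫ < p.2}`
has finite volume there are finitely many open H-polytopes `Q_j = ⋂_{q ∈ H' j} {⟪q.1, x⟫ < q.2}`,
bounded, with unit normals and pairwise distinct facet planes, pairwise disjoint, whose closures meet
pairwise inside planes `{⟪ν j j', x⟫ = b}` with `‖ν j j'‖ = 1`, each contained in `S`, and with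
`S =ᵐ ⋃ j, Q_j`. (Degenerate pieces are dropped, constraints normalised, pieces bounded by finite
volume, then `exists_disjoint_polytope_refinement` on the common arrangement.) -/
theorem exists_disjoint_polytope_refinement_of_volume_lt_top {k : ℕ} (H : Fin k → Finset (E × ℝ))
    (hv : volume (⋃ i, ⋂ p ∈ H i, {x : E | ⟪p.1, x⟫ < p.2}) < ⊤) :
    ∃ (k' : ℕ) (H' : Fin k' → Finset (E × ℝ)) (ν : Fin k' → Fin k' → E),
      (∀ j, Bornology.IsBounded (⋂ q ∈ H' j, {x : E | ⟪q.1, x⟫ < q.2})) ∧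
      (∀ j, ∀ q ∈ H' j, ‖q.1‖ = 1) ∧
      (∀ j, ∀ q ∈ H' j, ∀ q' ∈ H' j, q ≠ q' →
        {x : E | ⟪q.1, x⟫ = q.2} ≠ {x : E | ⟪q'.1, x⟫ = q'.2}) ∧
      (∀ j j', j ≠ j' → Disjoint (⋂ q ∈ H' j, {x : E | ⟪q.1, x⟫ < q.2})
        (⋂ q ∈ H' j', {x : E | ⟪q.1, x⟫ < q.2})) ∧
      (∀ j j', j ≠ j' → ‖ν j j'‖ = 1 ∧ ∃ b : ℝ,
        closure (⋂ q ∈ H' j, {x : E | ⟪q.1, x⟫ < q.2}) ∩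
          closure (⋂ q ∈ H' j', {x : E | ⟪q.1, x⟫ < q.2}) ⊆ {x : E | ⟪ν j j', x⟫ = b}) ∧
      (∀ j, (⋂ q ∈ H' j, {x : E | ⟪q.1, x⟫ < q.2}) ⊆ ⋃ i, ⋂ p ∈ H i, {x : E | ⟪p.1, x⟫ < p.2}) ∧
      ((⋃ i, ⋂ p ∈ H i, {x : E | ⟪p.1, x⟫ < p.2}) =ᵐ[volume]
        ⋃ j, ⋂ q ∈ H' j, {x : E | ⟪q.1, x⟫ < q.2}) := by
  -- normalised constraint sets of the non-degenerate pieces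
  set nrm : Finset (E × ℝ) → Finset (E × ℝ) := fun G =>
    (G.filter (fun p => p.1 ≠ 0)).image (fun p : E × ℝ => (‖p.1‖⁻¹ • p.1, ‖p.1‖⁻¹ * p.2)) with hnrm
  set I : Finset (Fin k) := Finset.univ.filter (fun i => ∀ p ∈ H i, p.1 = 0 → 0 < p.2) with hI
  set 𝒢 : Finset (Finset (E × ℝ)) := I.image (fun i => nrm (H i)) with h𝒢
  set 𝓗 : Finset (E × ℝ) := I.biUnion (fun i => nrm (H i)) with h𝓗
  -- the polyhedral set in terms of `𝒢`
  have hS : (⋃ i, ⋂ p ∈ H i, {x : E | ⟪p.1, x⟫ < p.2}) =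
      ⋃ G ∈ 𝒢, ⋂ p ∈ G, {x : E | ⟪p.1, x⟫ < p.2} := by
    apply Subset.antisymm
    · intro x hx
      rw [mem_iUnion] at hx
      obtain ⟨i, hxi⟩ := hx
      by_cases hi : ∀ p ∈ H i, p.1 = 0 → 0 < p.2
      · have hiI : i ∈ I := Finset.mem_filter.2 ⟨Finset.mem_univ _, hi⟩
        refine mem_iUnion₂.2 ⟨nrm (H i), Finset.mem_image.2 ⟨i, hiI, rfl⟩, ?_⟩
        rw [hnrm]; simp only
        rw [← polytope_eq_polytope_normalize (H i) hi]; exact hxi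
      · push Not at hi
        obtain ⟨p, hp, hp1, hp2⟩ := hi
        rw [polytope_eq_empty_of_degenerate (H i) hp hp1 hp2] at hxi
        exact absurd hxi (notMem_empty x)
    · intro x hx
      rw [mem_iUnion₂] at hx
      obtain ⟨G, hG, hxG⟩ := hx
      obtain ⟨i, hiI, rfl⟩ := Finset.mem_image.1 hG
      have hi : ∀ p ∈ H i, p.1 = 0 → 0 < p.2 := (Finset.mem_filter.1 hiI).2
      refine mem_iUnion.2 ⟨i, ?_⟩
      rw [polytope_eq_polytope_normalize (H i) hi]; exact hxG
  -- hypotheses of the refinement theorem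
  have h1 : ∀ p ∈ 𝓗, ‖p.1‖ = 1 := by
    intro p hp
    obtain ⟨i, -, hpi⟩ := Finset.mem_biUnion.1 hp
    exact norm_fst_eq_one_of_mem_normalize (H i) hpi
  have h𝒢 : ∀ G ∈ 𝒢, G ⊆ 𝓗 := by
    intro G hG
    obtain ⟨i, hiI, rfl⟩ := Finset.mem_image.1 hG
    exact Finset.subset_biUnion_of_mem (fun i => nrm (H i)) hiI
  have hb : ∀ G ∈ 𝒢, Bornology.IsBounded (⋂ p ∈ G, {x : E | ⟪p.1, x⟫ < p.2}) := by
    intro G hG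
    refine isBounded_hPolyhedron_of_volume_lt_top G (lt_of_le_of_lt (measure_mono ?_) hv)
    rw [hS]
    exact subset_iUnion₂ (s := fun G (_ : G ∈ 𝒢) => ⋂ p ∈ G, {x : E | ⟪p.1, x⟫ < p.2}) G hG
  obtain ⟨k', H', ν, hbd, hunit, hdist, hdisj, hplane, hsub, hae⟩ :=
    exists_disjoint_polytope_refinement 𝓗 h1 𝒢 h𝒢 hb
  refine ⟨k', H', ν, hbd, hunit, hdist, hdisj, hplane, fun j => ?_, ?_⟩
  · rw [hS]; exact hsub j
  · rw [hS]; exact hae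

end Summit.Ventures.Crystal3D.Theorems

end
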